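import Mathlib
import HarnessLib
import HarnessLib.Audit
import Summits.Langlands.Statement
import Literature.NumberTheory.GaloisRepresentations.ResidualGaloisRep
import Literature.NumberTheory.GaloisRepresentations.EnormousSubgroup
import Literature.NumberTheory.GaloisRepresentations.DecomposedGeneric
import Literature.NumberTheory.GaloisRepresentations.LabelledHodgeTateWeights
import Literature.NumberTheory.GaloisRepresentations.CrystallineDeformationRing
import HarnessLib.Audit.Status.Attr

/-!
Route: TameTypeSwitch

DORMANT since 2026-08-26T05:41:58Z (reconciler: no traction for 8.4 d (last activity item-evidence-added at 2026-08-17T19:45:29Z); parked, not closed — `ledger route dormant route-Langlands-TameTypeSwitch --off` to reactivate) — unstaffed, not closed; items shared with open routes are served there. `ledger route dormant <id> --off` reactivates.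

# Route TameTypeSwitch — family witnesses need only be right mod ℓ — tame hypergeometric points
typed at ℓ, consumed as Serre-weight torsion, reach gapped weights

It suffices to show X = GappedWeightPA (plus the declared junction SectorComplement : X → Langlands
for the rest of the summit): for every
CM field K, finite K^av/K, n ≥ 2, bound B, prime ℓ > n² with 2B+2 < ℓ UNRAMIFIED in K, ι : ℚ̄_ℓ ≃ ℂ,
and every continuous r : Γ_K → GL_n(ℚ̄_ℓ),
a.e. unramified, CRYSTALLINE at every v ∣ ℓ (pinned Fontaine datum) with REGULAR labelled Hodge–Tate
weights in [0,B] that are GAPPED somewhere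
(some (v,τ') has weights a < b < c with a, c present and b absent), and residually absolutely
irreducible, decomposed generic, enormous on
Γ_K(ζ_ℓ) with a scalar element off it — there is a finite Galois CM K'/K, linearly disjoint from
K^av, with ℓ unramified in K', over which r
is automorphic: a REGULAR ALGEBRAIC cuspidal Π of GL_n(𝔸_K'), unramified above ℓ, whose Satake
parameters give r|Γ_K' at every place above
every rational prime q ≠ ℓ above which Π is unramified. This is exactly the cell the
FamilyWitnessConsecutiveWeights barrier lists as BLOCKED
(`blocks:` "non-ordinary, non-polarizable, non-constant-λ_τ") and that StickelbergerDial's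
SectorComplement excludes ("other weights — blocked
for family methods"); BoxerEtAl2023 p. 7–8 leave it open in print ("cannot have consecutive
Hodge–Tate weights ... because of Griffiths
transversality"). No idea card is realised (barrier-inversion seat).
Lean: `∀ (K : Type) [Field K] [NumberField K], NumberField.IsCMField K → ∀ (Kav : Type) [Field Kav]
[Algebra K Kav], FiniteDimensional K Kav → ∀ (n B : ℕ), 2 ≤ n → ∀ (ℓ : ℕ) [Fact ℓ.Prime], n ^ 2 < ℓ
→ 2 * B + 2 < ℓ → Algebra.IsUnramifiedIn (NumberField.RingOfIntegers K) (Ideal.span {(ℓ : ℤ)}) → let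
k := Literature.NumberTheory.GaloisRepresentations.padicAlgClResidueField ℓ; ∀ (ι : PadicAlgCl ℓ ≃+*
ℂ) (r : Literature.NumberTheory.GaloisRepresentations.FramedGaloisRep K (PadicAlgCl ℓ) n) (τ :
Field.absoluteGaloisGroup K →* GL (Fin n) k), (∀ᶠ v in cofinite, r.IsUnramifiedAt v) → (∀ (v :
IsDedekindDomain.HeightOneSpectrum (NumberField.RingOfIntegers K)) (hv : (ℓ :
NumberField.RingOfIntegers K) ∈ v.asIdeal), let D :=
Literature.NumberTheory.PAdicHodge.fontainePstAdicCompletion v ℓ hv; D.IsCrystallineFramed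
(r.toLocal v) ∧ (letI := D.algebra; ∀ τ' : v.adicCompletion K →ₐ[ℚ_[ℓ]] PadicAlgCl ℓ,
(r.labelledHodgeTateWeightsAt v D.algebra D.𝔅 τ'.toRingHom).Nodup ∧ ∀ h ∈
r.labelledHodgeTateWeightsAt v D.algebra D.𝔅 τ'.toRingHom, 0 ≤ h ∧ h ≤ (B : ℤ))) → (∃ (v :
IsDedekindDomain.HeightOneSpectrum (NumberField.RingOfIntegers K)) (hv : (ℓ :
NumberField.RingOfIntegers K) ∈ v.asIdeal), let D :=
Literature.NumberTheory.PAdicHodge.fontainePstAdicCompletion v ℓ hv; letI := D.algebra; ∃ (τ' :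
v.adicCompletion K →ₐ[ℚ_[ℓ]] PadicAlgCl ℓ) (a b c : ℤ), a < b ∧ b < c ∧ a ∈
r.labelledHodgeTateWeightsAt v D.algebra D.𝔅 τ'.toRingHom ∧ c ∈ r.labelledHodgeTateWeightsAt v
D.algebra D.𝔅 τ'.toRingHom ∧ b ∉ r.labelledHodgeTateWeightsAt v D.algebra D.𝔅 τ'.toRingHom) →
r.IsResidualRepOf (RingHom.id _) τ → Literature.NumberTheory.GaloisRepresentations.IsAbsIrreducible
τ → Literature.NumberTheory.GaloisRepresentations.IsDecomposedGeneric τ → let H :=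
Literature.NumberTheory.GaloisRepresentations.absGaloisGroupAdjoinRootsOfUnity K ℓ;
Literature.NumberTheory.GaloisRepresentations.IsAbsIrreducible (τ.comp H.subtype) →
Literature.NumberTheory.GaloisRepresentations.Subgroup.IsEnormous (H.map τ) → (∃ σ :
Field.absoluteGaloisGroup K, σ ∉ H ∧ ∃ c : k, (τ σ).1 = c • 1) → ∃ (K' : Type) (_ : Field K') (_ :
NumberField K') (_ : Algebra K K'), IsGalois K K' ∧ NumberField.IsCMField K' ∧ IsField
(TensorProduct K Kav K') ∧ Algebra.IsUnramifiedIn (NumberField.RingOfIntegers K') (Ideal.span {(ℓ :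
ℤ)}) ∧ ∃ (hcpt' : _) (Pi : Literature.NumberTheory.Automorphic.CuspidalAutomorphicRepData n K'
hcpt'), Pi.1.IsRegularAlgebraic ∧ (∀ q : ℕ, q.Prime → q ≠ ℓ → (∀ w :
IsDedekindDomain.HeightOneSpectrum (NumberField.RingOfIntegers K'), (q : NumberField.RingOfIntegers
K') ∈ w.asIdeal → Pi.1.IsUnramifiedAt w) → ∀ v : IsDedekindDomain.HeightOneSpectrum
(NumberField.RingOfIntegers K'), (q : NumberField.RingOfIntegers K') ∈ v.asIdeal → ∀ α : Multiset ℂ,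
Pi.1.HasSatakeParamAt v α → (r.restrictField K').IsUnramifiedAt v ∧ (r.restrictField
K').HasFrobCharpolyAt v (Literature.NumberTheory.Automorphic.arithFrobPolyOfSatake ι v.residueCard n
α)) ∧ ∀ w : IsDedekindDomain.HeightOneSpectrum (NumberField.RingOfIntegers K'), (ℓ :
NumberField.RingOfIntegers K') ∈ w.asIdeal → Pi.1.IsUnramifiedAt w`

## Assembly
Pure logic (Sketch.lean `assembly_holds`, lean check rc 0, no sorry): fix the data of X;
TameTypedWitness gives K', hcpt', τ', π, r₀ with the
transported hypotheses and the typed witness; TypedWitnessFLLifting over F := K' (CM branch) applied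
to ρ := r|Γ_K' returns Π regular algebraic,
compatible, unramified above ℓ — X's conclusion; SectorComplement carries X to `Langlands`. The
deciding theorem is
closes (hW : TameTypedWitness) (hL : TypedWitnessFLLifting) (hJ : SectorComplement) (hA : Assembly)
: Langlands := hA hW hL hJ — every binder
consumed; Assembly itself is the curried implication below, provable now by the ten-line composition
in Sketch.lean.

Rationale: WHY THIS LINE. BARRIER INVERSION (operator C) on
Literature.Barriers.Langlands.FamilyWitnessConsecutiveWeights. The barrier's proved kernel
(Griffiths
transversality ⇒ gap-free Hodge numbers) binds only the CHARACTERISTIC-ZERO Hodge–Tate weights of a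
family witness, and its `blocks:` clause
needs the witness to be consumed by a SAME-WEIGHT characteristic-zero lifting theorem
(ACCGHLNSTT2023 Thm 6.1.1 (5)(b)); Fontaine–Laffaille
rigidity (ℓ unramified) then ties r̄|I_w to the weights, so the true wall is "no automorphic witness
with a GAPPED residual Fontaine–Laffaille
inertial pattern at an ℓ-unramified field". LEVER (new on this summit): consume the family only MOD
ℓ. The DESCENDED non-self-dual
hypergeometric family H(a/N; β ∣ s) on the s = t^N line (Katz1990ESDE Ch. 8: local monodromy at s =
0 semisimple with DISTINCT eigenvalues
e^(2πi a_j/N); BeukersCohenMellit2015 for the motives) has, at TAME points s (v_w(s) ≢ 0 mod N) of a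
CM K' ⊇ ℚ(ζ_N) with ℓ ∤ N, fibres that are
potentially crystalline of weight {0,…,n−1} with REGULAR depth-zero type diag(ζ_N^(k a_j)) and
reduction = Fermat fibre twisted LINE BY
LINE by ω^(k a_j (q−1)/N) — per-line tame shifts realise gapped FL digit patterns (scalar twists
provably cannot); taking N ∣ ℓ^f − 1 and
a_j ≡ (target exponent − Jacobi digit) makes the digit lemma solvable by design (n = 2 checked by
hand: a₁ = k−2, a₂ = (k−2)ℓ mod ℓ²−1). The
char-0 witness π (weight 0, depth zero at ℓ, automorphic by Qian2022's ℓ'-switch as in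
HarrisShepherdbarronTaylor2010 / BarnetlambEtAl2014
Prop 3.1.1) is then used RESIDUALLY: Shapiro moves its class to H*(X_K, σ̄(τ))_𝔪 whose Jordan–Hölder
pieces are Serre weights, among them
F(λ) (GeeKisin2014 philosophy), and the FL lifting of ACC+ §6 is re-anchored across the
Breuil–Mézard filtration (the derived Ihara
avoidance of ACCGHLNSTT2023 §6.3 with LeEtAl2022 local models for generic tame types giving unique
generization, typed/weighted torsion
local–global compatibility after ACCGHLNSTT2023 Thm 4.5.1 and CaraianiNewton2023). DEFECT-ZERO
ANCESTOR: Taylor2006 Lemma 5.6/Thm 5.7 (typed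
weight-2 HBAV witness at ℓ → mod-ℓ weight/type switch on definite quaternion Hecke algebras →
potential Serre in weight k_ρ → FL lifting);
BoxerEtAl2023 p. 8 print why the naive transplant fails when l₀ > 0 ("such lifts do not always
exist") — this route's crux 3 is the
statement that replaces "lift the residual class" by "transfer the char-0 anchor r itself".
Imported: rigid local systems / hypergeometric
motives (algebraic geometry), mod-ℓ representation theory of GL_n(𝔽_q) (Serre weights, Jantzen),
commutative algebra of patched complexes.
What prior routes do not: StickelbergerDial dials the SAME family at UNRAMIFIED points and consumes
the witness in characteristic zero (weight-0
cell only); NonParallelVoid feeds torsion into an EMPTY weight (n = 2, vacuity);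
EmbeddingNecklace/TriangulineChamber/WachComponentCensus are
GL₂ / polarizable; BaseFieldAscent/LiftDescend consume potential automorphy as a black box;
negatives index (4 typing refutations) untouched.

RANKED CRUXES. #0 GappedWeightPA (target) — X as in § Thesis — single-r potential automorphy over CM
fields in the gapped, ℓ-unramified Fontaine–Laffaille cell (non-ordinary allowed), conclusion over a
CM Galois K' with ℓ unramified in K'. (why it might fail: a gapped residual FL pattern may be
realised by NO tame point of any big-monodromy hypergeometric datum over an ℓ-unramified K', or the
cross-weight anchor transfer (crux 3) may genuinely need the folklore vanishing conjecture for
GL_n/CM.) [BoxerEtAl2023, ACCGHLNSTT2023, Qian2022, Taylor2006]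
#2 TameTypedWitness (crux) — THE DOOR — ℓ-unramified potential residual automorphy by a TYPED
weight-0 witness: under X's hypotheses (no gap clause needed) there are a finite Galois CM K'/K,
linearly disjoint from K^av, ℓ unramified in K', hcpt', a residual representation τ' of r|Γ_K'
(absolutely irreducible, decomposed generic, enormous on Γ_K'(ζ_ℓ), scalar off it), the transported
analytic hypotheses, and a WITNESS: a cuspidal π of GL_n(𝔸_K') of weight 0 with a non-zero vector
fixed by the principal congruence subgroup K(𝔫·ℓ), 𝔫 prime to ℓ (depth zero above ℓ; π is NOT asked
to be unramified above ℓ), and a framed r₀ with the Satake–Frobenius property of r_ι(π) whose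
residual representation is τ'. Mechanism: tame Moret-Bailly points of descended non-self-dual
hypergeometric families with N ∣ ℓ^f − 1 and parameters a_j ≡ target exponents (digit lemma),
Frobenius part killed by unramified enlargement of K', Qian's ℓ'-switch for the automorphy of the
fibre. [difficulty: L] (why it might fail: the mod-ℓ monodromy of level-N (N ∣ ℓ^f−1, N > ℓ)
hypergeometric sheaves may be too small for the twisted Moret-Bailly cover to be geometrically
irreducible, or non-semisimple r̄|Γ_K_v / non-interlaced Hodge data may be unreachable by tame
points.) [Katz1990ESDE, BeukersCohenMellit2015, Qian2022, BarnetlambEtAl2014,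
HarrisShepherdbarronTaylor2010, GuralnickHarrisKatz2010, Katz2009]
#3 TypedWitnessFLLifting (crux) — Fontaine–Laffaille automorphy lifting for GL_n over CM or totally
real F with a TYPED witness: ACC+ Thm 6.1.1 (p > n², p unramified, ρ crystalline with regular
labelled weights in [0,B], 2B+2 < p, residual conditions as printed) with hypothesis (5) "π of
weight λ unramified above p" REPLACED by "π cuspidal of weight 0, depth zero above p (K(𝔫·p)-fixed
vector, 𝔫 prime to p), r₀ with the Satake–Frobenius property of r_ι(π) and the same residual
representation" ⇒ ρ is automorphic: a regular algebraic cuspidal Π, unramified above p,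
Satake–Frobenius compatible with ρ. Foreseen proof = two layer-2 children (§ Two-layer plan):
typed/weighted torsion local–global compatibility at Iwahori level, and the cross-weight anchor
transfer (derived Ihara avoidance across the Breuil–Mézard filtration of σ̄(τ), unique generization
from LLHLM local models). [difficulty: open-problem] (why it might fail: stray upper-alcove
constituents of σ̄(τ) need torsion local–global compatibility beyond the Fontaine–Laffaille range
(open for n ≥ 3), and transferring the anchor across weights may need the folklore vanishing of
H*(X_K,k)_𝔪 outside [q₀,q₀+l₀].) [ACCGHLNSTT2023, BoxerEtAl2023, CaraianiNewton2023, LeEtAl2022,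
GeeKisin2014, EmertonGee2022, Taylor2008, Taylor2006]
#9 SectorComplement (crux) — the junction X → Langlands: everything in the summit outside the gapped
Fontaine–Laffaille potential-automorphy cell over CM fields (descent K' → K, the consecutive-weight
cell (StickelbergerDial), weights outside the FL box, irregular π, non-CM F, direction (A),
local–global compatibility at every place, the reciprocity data 𝓡). Not this route's business; filed
so that closes ends in the summit constant (pattern of StickelbergerDial.SectorComplement,
AnalyticDescent.SectorComplement, EisensteinGelfandKirillov.SectorComplement). [deps:
GappedWeightPA] [difficulty: open-problem] (why it might fail: it is the rest of GL_n reciprocity: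
fails if (A) fails for an irregular π or (B) fails beyond the regular CM world while X holds;
potential ⇒ actual automorphy over K needs insoluble descent (SolvableImageBarrier).)
[BuzzardGeeLMS2014, FontaineMazurGeometric1995, Calegari2023, ACCGHLNSTT2023]

TWO-LAYER PLAN. TypedWitnessFLLifting ⇐ TypedTorsionCompatibility (the Galois determinant of
𝕋(K^pK₁(w), σ(τ))_𝔪 and of 𝕋(K, V_μ)_𝔪 for the Jordan–Hölder
constituents F(μ) of σ̄(τ) is supported on the corresponding Emerton–Gee cycles Z(τ,0) / Z(μ) — ACC+
Thm 4.5.1 extended to Iwahori level and to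
the p-restricted range, after CaraianiNewton2023) → CrossWeightAnchorTransfer (ACC+ §6.3 Assumption
95/Prop. 100 run with R' = R^(λ-FL)
(irreducible, contains ρ) and R = R^(0,τ) (anchor π), R'/ϖ a component of R/ϖ with unique
generization by LeEtAl2022 Thm 9.2.1-type local
models, C'⊗k the F(λ)-graded piece of C⊗k; the stray pieces miss the generic point of Z(λ)) →
TypedWitnessFLLifting; both children need the
torsion Hecke-support predicate (§ Definition requests) before they can be typed. TameTypedWitness ⇐
TameDigitLemma (pure arithmetic: for every
regular FL exponent vector over k_w there are N ∣ #k_w − 1 and distinct hypergeometric numerators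
a_j with Jacobi digit + tame shift = target) →
TameMoretBaillyLink (BLGGT Prop 3.1.1 with E'_w unramified of large degree, mod-ℓ monodromy of
H(a/N; β), ℓ'-side ordinary partner) →
TameTypedWitness. n = 2, f_w = 2 is the calibration rung (both Serre weights of a niveau-2 r̄ are
Fontaine–Laffaille for 5 ≤ k ≤ ℓ−2). Nothing
filed now.

KILL CRITERIA. (K1) A computation (n = 2, 3; ℓ ∈ {7, 11, 13}) showing that tame points of level-N
hypergeometric data with big mod-ℓ monodromy realise NO
gapped niveau-n pattern ⇒ TameTypedWitness false as stated for irreducible r̄|Γ_K_v: restate to the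
realised patterns or close
refuted:TameTypedWitness. (K2) A refuter proving that any anchor transfer from (type τ, weight 0) to
(FL, weight λ) in l₀ > 0 implies the
folklore vanishing conjecture for GL_n/CM ⇒ TypedWitnessFLLifting is vanishing-conjecture-hard: keep
the route only as the explicit bridge
(re-open --conditional-bridge on the vanishing statement) or close superseded by
NonParallelVoid-type torsion routes. (K3) A printed
potential-automorphy theorem for single non-ordinary r of non-alignable gapped weight over CM fields
(extension of BoxerEtAl2023 beyond parallel
weight) ⇒ novelty gone: re-file X as a Literature fact, close superseded. X proved elsewhere moots
the route.

NOT DECOMPOSED YET. The digit lemma and the tame Moret-Bailly link (layer-2 of crux 2); the two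
children of crux 3 (need a torsion Hecke-support definition); the
ℓ'-side (ordinary partner, enormous image along K', p-q(-r) switch as in BoxerEtAl2023 §6) —
bookkeeping shared with StickelbergerDial/Qian;
descent K' → K (LiftDescend, AnalyticDescent); the consecutive-weight cell (StickelbergerDial) and
weights outside the FL box (WachComponentCensus,
TriangulineChamber) deliberately excluded; Ramanujan for weight-k cohomological GL₂/CM forms of
NON-parallel weight over general CM fields is the
flagship corollary but is not filed (it needs X for Sym^m r_π plus the standard Sato–Tate
bookkeeping of BoxerEtAl2023 §7).

CHEAPEST FALSIFIER. (i) Literature (ran 2026-08-17): arXiv/zbMATH/local for "potential automorphy" +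
"potentially crystalline"/"tame type"/"Serre weight" +
CM: nearest BoxerEtAl2023 (parallel weight only, Harris trick + weight-0 lifting, non-parallel
explicitly open), Qian2022 (ordinary),
GuralnickHarrisKatz2010 (stably potentially automorphic, F' highly ramified at ℓ — "(b) ℓ unramified
in F', which we cannot guarantee"),
Taylor2006 Thm 5.7 (defect zero). (ii) By hand: n = 2, f = 2 digit lemma solved (a₁ = k−2, a₂ =
(k−2)ℓ mod ℓ²−1, distinct for 2 < k < ℓ+3);
scalar tame twists checked NOT to change the Serre gap vector (so descended families with non-scalar
finite monodromy are essential). (iii)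
For the refuter: pari/Magma table of mod-ℓ monodromy groups of H((k−2)/N,(k−2)ℓ/N; 0,0), N = ℓ²−1, ℓ
∈ {7,11} — one afternoon; if the
monodromy is solvable/finite for these parameters, crux 2 needs other β.

NUMBERS. ℓ > n² and 2B+2 < ℓ (ACC+ 6.1.1 (4),(5a) rewritten: spread_τ + spread_τc < ℓ − 2 with HT ⊂
[0,B]); N ∣ ℓ^f − 1 with f = residue degree at w
(f = 2 reaches every niveau-2 r̄_v of GL₂(ℚ_ℓ) after unramified quadratic enlargement); Serre
weights of σ̄(τ) for GL₂(𝔽_ℓ):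
{Sym^a, Sym^(ℓ−1−a)⊗det^a}, both Fontaine–Laffaille iff 3 ≤ a ≤ ℓ−4; Bianchi Ramanujan known for
parallel weight k ≥ 2 (BoxerEtAl2023 Thm A),
weight 0 over CM (ACCGHLNSTT2023 Thm 2); items at open: 5.

DEFINITION REQUESTS. Wanted (to be filed with this route, `--for` crux 3): `TorsionHeckeSupport` —
for K ⊂ GL_n(𝔸_F^∞) good, an 𝒪[K_p]-module V of finite type
(algebraic weight V_λ, a type σ(τ), or a Serre weight F(μ)) and a residual ρ̄, the predicate "𝔪_ρ̄
is in the support of H*(X_K, V)"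
(Betti cohomology of the locally symmetric space with the local system of V; ACC+ §2.2), topic
Literature/NumberTheory/Automorphic. With it the
two layer-2 children of crux 3 become typable. Not needed: a general-weight `HasWeight λ` predicate
(the conclusion is phrased by regular
algebraicity + Satake–Frobenius compatibility; the weight is forced by ρ).

Novelty: Searches (2026-08-17): `lit search "Ramanujan Sato-Tate Bianchi modular forms Boxer Calegari Gee
Newton Thorne"` (1: arXiv:2309.15880, read
pp. 1–10: the nearest prior art); `lit read paper:arxiv-1812.09999` §6.1, §6.3 (Assumption 95
generic concentration, Prop. 100), §6.5 (Thm
119/Cor 120) — the char-0 anchor; `lit read paper:arxiv-1909.01898` pp. 3–5 (folklore vanishing open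
for GL_n/F); `lit search "Guralnick
Harris Katz automorphic realization"` (held, read §1–3); `lit read` Taylor2006 pp. 42–43 (Lemma 5.6,
Thm 5.7); `lit search --hybrid "potential
automorphy Dwork family potentially crystalline tame type Serre weight residual representation
inertial type"` (15; relevant: CaraianiNewton2023,
Taylor2006, Qian2022, Yang arXiv:2407.00288 — none uses typed family points for gapped weights);
tree: 92 thesis files + 131 cards grepped for
Serre weight / weight part / Breuil–Mézard / Dwork / hypergeometric (StickelbergerDial,
NonParallelVoid, EmbeddingNecklace, WachComponentCensus,
TriangulineChamber, torsion-gauge card read); barrier catalogue (12) read in full; `ledger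
negatives` (4). OpenAlex/S2 rate-limited (HTTP 429)
all session, galaxy not reachable from this seat's searches — noted for the refuter.
Nearest prior art found: BoxerEtAl2023 (gapped weights reached ONLY for parallel weight via the
Harris tensor trick + a weight-0 lifting
theorem with p ramified; non-parallel left open, p. 7–8); Taylor2006 Thm 5.7 (the defect-zero
typed-witness + Serre-weight switch);
ACCGHLNSTT  [refs: 2309.15880, 2407.00288, paper:arxiv-1812.09999, paper:arxiv-1909.01898, Taylor2006, CaraianiNewton2023, Qian2022, BoxerEtAl2023, ACCGHLNSTT2023, GuralnickHarrisKatz2010]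

Barriers (technique_class: potential-automorphy, serre-weight-switch, cg-patching): - technique_class: potential-automorphy, hypergeometric-tame-type, serre-weight-switch,
calegari-geraghty-patching, derived-ihara-avoidance
- Literature.Barriers.Langlands.FamilyWitnessConsecutiveWeights: EVADED by construction — the
barrier's theorem (`FamilyWitnessConsecutiveWeights_holds`, `not_isFamilyRealizable_of_gap`)
constrains the characteristic-zero Hodge–Tate multiset of a connected-family fibre, and its
`blocks:` clause needs that fibre to feed a SAME-WEIGHT char-0 lifting clause; here the fibre is
potentially crystalline of consecutive weight but is consumed only through its REDUCTION, whose
Serre weights are gapped (per-line tame twist), so the escaping hypothesis is exactly "same-weight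
characteristic-zero consumption".
- Literature.Barriers.Langlands.PatchingLocalComponentBarrier: evaded for the TARGET ring
(Fontaine–Laffaille crystalline deformation rings are formally smooth, one component, ACC+ Prop.
82); engaged for the typed witness ring R^(0,τ), whose special-fibre components are labelled by
Serre weights — the bet is unique generization from LeEtAl2022 local models (generic tame types),
the same input CaraianiNewton2023/BoxerEtAl2023 use in weight 0.
- Literature.Barriers.Langlands.TaylorWilesNumericalCoincidence: not evaded, met head-on by
positive-defect (Calegari–Geraghty) patching as in ACCGHLNSTT2023 §6; the route inherits its inputs
(torsion Galois representations, decomposed genericity).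
- Literature.Barriers.Langlands.ResiduallyReducibleBarrier:

History (route lifecycle, newest last):
- 2026-08-26T05:41:58Z · DORMANT — reconciler: no traction for 8.4 d (last activity item-evidence-added at 2026-08-17T19:45:29Z); parked, not closed — `ledger route dormant route-Langlands-TameTy (operator:999:700848)

sub-problem: Langlands · status: dormant · opened planner-plan-novel-Langlands-Langlands-e266a39d-c-v2-g20-0 2026-08-17T14:44:49Z · rev 2 · ledger route-Langlands-TameTypeSwitch
GENERATED by the gate from the ledger (D-0016/17). Provers cite these decls: `theorem foo : Summit.Langlands.Langlands.Theses.TameTypeSwitch.<Decl> := …` in Summits/Langlands/Langlands/Theorems/<Name>.lean.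
-/

namespace Summit.Langlands.Langlands.Theses.TameTypeSwitch

open scoped BigOperators Topology Manifold Classical MeasureTheory ProbabilityTheory Matrix InnerProductSpace ComplexConjugate ContinuousMap
open Filter Set Function TopologicalSpace MeasureTheory

attribute [summit_statement] _root_.Langlands

/-- item stmt-Langlands-18268 · target · rank 0 · open · by planner
why it might fail: a gapped residual FL pattern may be realised by NO tame point of any big-monodromy hypergeometric datum over an ℓ-unramified K', or the cross-weight anchor transfer (crux 3) may genuinely need the folklore vanishing conjecture for GL_n/CM.
sources: BoxerEtAl2023, ACCGHLNSTT2023, Qian2022, Taylor2006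
[target] X as in § Thesis — single-r potential automorphy over CM fields in the gapped, ℓ-unramified
Fontaine–Laffaille cell (non-ordinary allowed), conclusion over a CM Galois K' with ℓ unramified in
K'. -/
@[route_item "route-Langlands-TameTypeSwitch"]
def GappedWeightPA : Prop :=
  ∀ (K : Type) [Field K] [NumberField K], NumberField.IsCMField K → ∀ (Kav : Type) [Field Kav] [Algebra K Kav], FiniteDimensional K Kav → ∀ (n B : ℕ), 2 ≤ n → ∀ (ℓ : ℕ) [Fact ℓ.Prime], n ^ 2 < ℓ → 2 * B + 2 < ℓ → Algebra.IsUnramifiedIn (NumberField.RingOfIntegers K) (Ideal.span {(ℓ : ℤ)}) → let k := Literature.NumberTheory.GaloisRepresentations.padicAlgClResidueField ℓ; ∀ (ι : PadicAlgCl ℓ ≃+* ℂ) (r : Literature.NumberTheory.GaloisRepresentations.FramedGaloisRep K (PadicAlgCl ℓ) n) (τ : Field.absoluteGaloisGroup K →* GL (Fin n) k), (∀ᶠ v in cofinite, r.IsUnramifiedAt v) → (∀ (v : IsDedekindDomain.HeightOneSpectrum (NumberField.RingOfIntegers K)) (hv : (ℓ : NumberField.RingOfIntegers K) ∈ v.asIdeal),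 let D := Literature.NumberTheory.PAdicHodge.fontainePstAdicCompletion v ℓ hv; D.IsCrystallineFramed (r.toLocal v) ∧ (letI := D.algebra; ∀ τ' : v.adicCompletion K →ₐ[ℚ_[ℓ]] PadicAlgCl ℓ, (r.labelledHodgeTateWeightsAt v D.algebra D.𝔅 τ'.toRingHom).Nodup ∧ ∀ h ∈ r.labelledHodgeTateWeightsAt v D.algebra D.𝔅 τ'.toRingHom, 0 ≤ h ∧ h ≤ (B : ℤ))) → (∃ (v : IsDedekindDomain.HeightOneSpectrum (NumberField.RingOfIntegers K)) (hv : (ℓ : NumberField.RingOfIntegers K) ∈ v.asIdeal), let D := Literature.NumberTheory.PAdicHodge.fontainePstAdicCompletion v ℓ hv; letI := D.algebra; ∃ (τ' : v.adicCompletion K →ₐ[ℚ_[ℓ]] PadicAlgCl ℓ) (a b c : ℤ), a < b ∧ b < c ∧ a ∈ r.labelledHodgeTateWeightsAt v D.algebra D.𝔅 τ'.toRingHom ∧ c ∈ r.labelledHodgeTateWeightsAt v D.algebra D.𝔅 τ'.toRingHom ∧ b ∉ r.labelledHodgeTateWeightsAt v D.algebra D.𝔅 τ'.toRingHom) → r.IsResidualRepOf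 (RingHom.id _) τ → Literature.NumberTheory.GaloisRepresentations.IsAbsIrreducible τ → Literature.NumberTheory.GaloisRepresentations.IsDecomposedGeneric τ → let H := Literature.NumberTheory.GaloisRepresentations.absGaloisGroupAdjoinRootsOfUnity K ℓ; Literature.NumberTheory.GaloisRepresentations.IsAbsIrreducible (τ.comp H.subtype) → Literature.NumberTheory.GaloisRepresentations.Subgroup.IsEnormous (H.map τ) → (∃ σ : Field.absoluteGaloisGroup K, σ ∉ H ∧ ∃ c : k, (τ σ).1 = c • 1) → ∃ (K' : Type) (_ : Field K') (_ : NumberField K') (_ : Algebra K K'), IsGalois K K' ∧ NumberField.IsCMField K' ∧ IsField (TensorProduct K Kav K') ∧ Algebra.IsUnramifiedIn (NumberField.RingOfIntegers K') (Ideal.span {(ℓ : ℤ)}) ∧ ∃ (hcpt' : _) (Pi : Literature.NumberTheory.Automorphic.CuspidalAutomorphicRepData n K' hcpt'), Pi.1.IsRegularAlgebraic ∧ (∀ q : ℕ, q.Prime → q ≠ ℓ → (∀ w : IsDedekindDomain.HeightOneSpectrum (NumberField.RingOfIntegers K'), (q : NumberField.RingOfIntegers K') ∈ w.asIdeal → Pi.1.IsUnramifiedAt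 w) → ∀ v : IsDedekindDomain.HeightOneSpectrum (NumberField.RingOfIntegers K'), (q : NumberField.RingOfIntegers K') ∈ v.asIdeal → ∀ α : Multiset ℂ, Pi.1.HasSatakeParamAt v α → (r.restrictField K').IsUnramifiedAt v ∧ (r.restrictField K').HasFrobCharpolyAt v (Literature.NumberTheory.Automorphic.arithFrobPolyOfSatake ι v.residueCard n α)) ∧ ∀ w : IsDedekindDomain.HeightOneSpectrum (NumberField.RingOfIntegers K'), (ℓ : NumberField.RingOfIntegers K') ∈ w.asIdeal → Pi.1.IsUnramifiedAt w

/-- item stmt-Langlands-18269 · crux · rank 2 · open · by planner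
why it might fail: the mod-ℓ monodromy of level-N (N ∣ ℓ^f−1, N > ℓ) hypergeometric sheaves may be too small for the twisted Moret-Bailly cover to be geometrically irreducible, or non-semisimple r̄|Γ_K_v / non-interlaced Hodge data may be unreachable by tame points.
sources: Katz1990ESDE, BeukersCohenMellit2015, Qian2022, BarnetlambEtAl2014, HarrisShepherdbarronTaylor2010, GuralnickHarrisKatz2010
[crux] THE DOOR — ℓ-unramified potential residual automorphy by a TYPED weight-0 witness: under X's
hypotheses (no gap clause needed) there are a finite Galois CM K'/K, linearly disjoint from K^av, ℓ
unramified in K', hcpt', a residual representation τ' of r|Γ_K' (absolutely irreducible, decomposed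
generic, enormous on Γ_K'(ζ_ℓ), scalar off it), the transported analytic hypotheses, and a WITNESS:
a cuspidal π of GL_n(𝔸_K') of weight 0 with a non-zero vector fixed by the principal congruence
subgroup K(𝔫·ℓ), 𝔫 prime to ℓ (depth zero above ℓ; π is NOT asked to be unramified above ℓ), and a
framed r₀ with the Satake–Frobenius property of r_ι(π) whose residual representation is τ'.
Mechanism: tame Moret-Bailly points of descended non-self-dual hypergeometric families with N ∣ ℓ^f
− 1 and parameters a_j ≡ target exponents (digit lemma), Frobenius part killed by unramified
enlargement of K', Qian's ℓ'-switch for the automorphy of the fibre. [difficulty: L] -/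
@[route_item "route-Langlands-TameTypeSwitch", crux]
def TameTypedWitness : Prop :=
  ∀ (K : Type) [Field K] [NumberField K], NumberField.IsCMField K → ∀ (Kav : Type) [Field Kav] [Algebra K Kav], FiniteDimensional K Kav → ∀ (n B : ℕ), 2 ≤ n → ∀ (ℓ : ℕ) [Fact ℓ.Prime], n ^ 2 < ℓ → 2 * B + 2 < ℓ → Algebra.IsUnramifiedIn (NumberField.RingOfIntegers K) (Ideal.span {(ℓ : ℤ)}) → let k := Literature.NumberTheory.GaloisRepresentations.padicAlgClResidueField ℓ; ∀ (ι : PadicAlgCl ℓ ≃+* ℂ) (r : Literature.NumberTheory.GaloisRepresentations.FramedGaloisRep K (PadicAlgCl ℓ) n) (τ : Field.absoluteGaloisGroup K →* GL (Fin n) k), (∀ᶠ v in cofinite, r.IsUnramifiedAt v) → (∀ (v : IsDedekindDomain.HeightOneSpectrum (NumberField.RingOfIntegers K)) (hv : (ℓ : NumberField.RingOfIntegers K) ∈ v.asIdeal), let D := Literature.NumberTheory.PAdicHodge.fontainePstAdicCompletion v ℓ hv; D.IsCrystallineFramed (r.toLocal v) ∧ (letI := D.algebra; ∀ τ' : v.adicCompletion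 K →ₐ[ℚ_[ℓ]] PadicAlgCl ℓ, (r.labelledHodgeTateWeightsAt v D.algebra D.𝔅 τ'.toRingHom).Nodup ∧ ∀ h ∈ r.labelledHodgeTateWeightsAt v D.algebra D.𝔅 τ'.toRingHom, 0 ≤ h ∧ h ≤ (B : ℤ))) → r.IsResidualRepOf (RingHom.id _) τ → Literature.NumberTheory.GaloisRepresentations.IsAbsIrreducible τ → Literature.NumberTheory.GaloisRepresentations.IsDecomposedGeneric τ → let H := Literature.NumberTheory.GaloisRepresentations.absGaloisGroupAdjoinRootsOfUnity K ℓ; Literature.NumberTheory.GaloisRepresentations.IsAbsIrreducible (τ.comp H.subtype) → Literature.NumberTheory.GaloisRepresentations.Subgroup.IsEnormous (H.map τ) → (∃ σ : Field.absoluteGaloisGroup K, σ ∉ H ∧ ∃ c : k, (τ σ).1 = c • 1) → ∃ (K' : Type) (_ : Field K') (_ : NumberField K') (_ : Algebra K K'), let O' := NumberField.RingOfIntegers K'; let P' := IsDedekindDomain.HeightOneSpectrum O'; let H' := Literature.NumberTheory.GaloisRepresentations.absGaloisGroupAdjoinRootsOfUnity K' ℓ; IsGalois K K' ∧ NumberField.IsCMField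 K' ∧ IsField (TensorProduct K Kav K') ∧ Algebra.IsUnramifiedIn (O') (Ideal.span {(ℓ : ℤ)}) ∧ ∃ (hcpt' : _) (τ' : Field.absoluteGaloisGroup K' →* GL (Fin n) k) (π : Literature.NumberTheory.Automorphic.CuspidalAutomorphicRepData n K' hcpt') (r₀ : Literature.NumberTheory.GaloisRepresentations.FramedGaloisRep K' (PadicAlgCl ℓ) n), (∀ᶠ w in cofinite, (r.restrictField K').IsUnramifiedAt w) ∧ (∀ (w : P') (hw : (ℓ : O') ∈ w.asIdeal), let D := Literature.NumberTheory.PAdicHodge.fontainePstAdicCompletion w ℓ hw; D.IsCrystallineFramed ((r.restrictField K').toLocal w) ∧ (letI := D.algebra; ∀ τ'' : w.adicCompletion K' →ₐ[ℚ_[ℓ]] PadicAlgCl ℓ, ((r.restrictField K').labelledHodgeTateWeightsAt w D.algebra D.𝔅 τ''.toRingHom).Nodup ∧ ∀ h ∈ (r.restrictField K').labelledHodgeTateWeightsAt w D.algebra D.𝔅 τ''.toRingHom, 0 ≤ h ∧ h ≤ (B : ℤ))) ∧ (r.restrictField K').IsResidualRepOf (RingHom.id _) τ' ∧ Literature.NumberTheory.GaloisRepresentations.IsAbsIrreducible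 τ' ∧ Literature.NumberTheory.GaloisRepresentations.IsDecomposedGeneric τ' ∧ Literature.NumberTheory.GaloisRepresentations.IsAbsIrreducible (τ'.comp H'.subtype) ∧ Literature.NumberTheory.GaloisRepresentations.Subgroup.IsEnormous (H'.map τ') ∧ (∃ σ : Field.absoluteGaloisGroup K', σ ∉ H' ∧ ∃ c : k, (τ' σ).1 = c • 1) ∧ π.1.HasWeightZero ∧ (∀ q : ℕ, q.Prime → q ≠ ℓ → (∀ w : P', (q : O') ∈ w.asIdeal → π.1.IsUnramifiedAt w) → ∀ v : P', (q : O') ∈ v.asIdeal → ∀ α : Multiset ℂ, π.1.HasSatakeParamAt v α → r₀.IsUnramifiedAt v ∧ r₀.HasFrobCharpolyAt v (Literature.NumberTheory.Automorphic.arithFrobPolyOfSatake ι v.residueCard n α)) ∧ r₀.IsResidualRepOf (RingHom.id _) τ' ∧ ∃ 𝔫 : Ideal (O'), 𝔫 ≠ 0 ∧ (∀ w : P', (ℓ : O') ∈ w.asIdeal → ¬ w.asIdeal ∣ 𝔫) ∧ ∃ φ ∈ π.1.W, φ ∉ π.1.W' ∧ ∀ u ∈ Literature.NumberTheory.Automorphic.principalCongruenceLevel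 n K' (𝔫 * Ideal.span {(ℓ : O')}), Literature.NumberTheory.Automorphic.rightTranslation (Literature.NumberTheory.Automorphic.AdelicGroupData.gl n K') u φ = φ

/-- item stmt-Langlands-18270 · crux · rank 3 · open · by planner
why it might fail: stray upper-alcove constituents of σ̄(τ) need torsion local–global compatibility beyond the Fontaine–Laffaille range (open for n ≥ 3), and transferring the anchor across weights may need the folklore vanishing of H*(X_K,k)_𝔪 outside [q₀,q₀+l₀].
sources: ACCGHLNSTT2023, BoxerEtAl2023, CaraianiNewton2023, LeEtAl2022, GeeKisin2014, EmertonGee2022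
[crux] Fontaine–Laffaille automorphy lifting for GL_n over CM or totally real F with a TYPED
witness: ACC+ Thm 6.1.1 (p > n², p unramified, ρ crystalline with regular labelled weights in [0,B],
2B+2 < p, residual conditions as printed) with hypothesis (5) "π of weight λ unramified above p"
REPLACED by "π cuspidal of weight 0, depth zero above p (K(𝔫·p)-fixed vector, 𝔫 prime to p), r₀ with
the Satake–Frobenius property of r_ι(π) and the same residual representation" ⇒ ρ is automorphic: a
regular algebraic cuspidal Π, unramified above p, Satake–Frobenius compatible with ρ. Foreseen proof
= two layer-2 children (§ Two-layer plan): typed/weighted torsion local–global compatibility at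
Iwahori level, and the cross-weight anchor transfer (derived Ihara avoidance across the
Breuil–Mézard filtration of σ̄(τ), unique generization from LLHLM local models). [difficulty:
open-problem] -/
@[route_item "route-Langlands-TameTypeSwitch", crux]
def TypedWitnessFLLifting : Prop :=
  ∀ (F : Type) [Field F] [NumberField F], NumberField.IsTotallyReal F ∨ NumberField.IsCMField F → ∀ (n B : ℕ) (hcpt : Literature.NumberTheory.Automorphic.isCompact_glFiniteIntegralLevel n F) (p : ℕ) [Fact p.Prime], n ^ 2 < p → 2 * B + 2 < p → Algebra.IsUnramifiedIn (NumberField.RingOfIntegers F) (Ideal.span {(p : ℤ)}) → let k := Literature.NumberTheory.GaloisRepresentations.padicAlgClResidueField p; ∀ (ι : PadicAlgCl p ≃+* ℂ) (ρ : Literature.NumberTheory.GaloisRepresentations.FramedGaloisRep F (PadicAlgCl p) n) (τ : Field.absoluteGaloisGroup F →* GL (Fin n) k) (π : Literature.NumberTheory.Automorphic.CuspidalAutomorphicRepData n F hcpt) (r : Literature.NumberTheory.GaloisRepresentations.FramedGaloisRep F (PadicAlgCl p) n), (∀ᶠ v in cofinite, ρ.IsUnramifiedAt v) → (∀ (v :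 IsDedekindDomain.HeightOneSpectrum (NumberField.RingOfIntegers F)) (hv : (p : NumberField.RingOfIntegers F) ∈ v.asIdeal), let D := Literature.NumberTheory.PAdicHodge.fontainePstAdicCompletion v p hv; D.IsCrystallineFramed (ρ.toLocal v) ∧ (letI := D.algebra; ∀ τ' : v.adicCompletion F →ₐ[ℚ_[p]] PadicAlgCl p, (ρ.labelledHodgeTateWeightsAt v D.algebra D.𝔅 τ'.toRingHom).Nodup ∧ ∀ h ∈ ρ.labelledHodgeTateWeightsAt v D.algebra D.𝔅 τ'.toRingHom, 0 ≤ h ∧ h ≤ (B : ℤ))) → ρ.IsResidualRepOf (RingHom.id _) τ → Literature.NumberTheory.GaloisRepresentations.IsAbsIrreducible τ → Literature.NumberTheory.GaloisRepresentations.IsDecomposedGeneric τ → let H := Literature.NumberTheory.GaloisRepresentations.absGaloisGroupAdjoinRootsOfUnity F p; Literature.NumberTheory.GaloisRepresentations.IsAbsIrreducible (τ.comp H.subtype) → Literature.NumberTheory.GaloisRepresentations.Subgroup.IsEnormous (H.map τ) → (∃ σ : Field.absoluteGaloisGroup F, σ ∉ H ∧ ∃ c : k, (τ σ).1 = c • 1)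 → π.1.HasWeightZero → (∀ q : ℕ, q.Prime → q ≠ p → (∀ w : IsDedekindDomain.HeightOneSpectrum (NumberField.RingOfIntegers F), (q : NumberField.RingOfIntegers F) ∈ w.asIdeal → π.1.IsUnramifiedAt w) → ∀ v : IsDedekindDomain.HeightOneSpectrum (NumberField.RingOfIntegers F), (q : NumberField.RingOfIntegers F) ∈ v.asIdeal → ∀ α : Multiset ℂ, π.1.HasSatakeParamAt v α → r.IsUnramifiedAt v ∧ r.HasFrobCharpolyAt v (Literature.NumberTheory.Automorphic.arithFrobPolyOfSatake ι v.residueCard n α)) → r.IsResidualRepOf (RingHom.id _) τ → (∃ 𝔫 : Ideal (NumberField.RingOfIntegers F), 𝔫 ≠ 0 ∧ (∀ w : IsDedekindDomain.HeightOneSpectrum (NumberField.RingOfIntegers F), (p : NumberField.RingOfIntegers F) ∈ w.asIdeal → ¬ w.asIdeal ∣ 𝔫) ∧ ∃ φ ∈ π.1.W, φ ∉ π.1.W' ∧ ∀ u ∈ Literature.NumberTheory.Automorphic.principalCongruenceLevel n F (𝔫 * Ideal.span {(p : NumberField.RingOfIntegers F)}), Literature.NumberTheory.Automorphic.rightTranslation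 (Literature.NumberTheory.Automorphic.AdelicGroupData.gl n F) u φ = φ) → ∃ Pi : Literature.NumberTheory.Automorphic.CuspidalAutomorphicRepData n F hcpt, Pi.1.IsRegularAlgebraic ∧ (∀ q : ℕ, q.Prime → q ≠ p → (∀ w : IsDedekindDomain.HeightOneSpectrum (NumberField.RingOfIntegers F), (q : NumberField.RingOfIntegers F) ∈ w.asIdeal → Pi.1.IsUnramifiedAt w) → ∀ v : IsDedekindDomain.HeightOneSpectrum (NumberField.RingOfIntegers F), (q : NumberField.RingOfIntegers F) ∈ v.asIdeal → ∀ α : Multiset ℂ, Pi.1.HasSatakeParamAt v α → ρ.IsUnramifiedAt v ∧ ρ.HasFrobCharpolyAt v (Literature.NumberTheory.Automorphic.arithFrobPolyOfSatake ι v.residueCard n α)) ∧ ∀ v : IsDedekindDomain.HeightOneSpectrum (NumberField.RingOfIntegers F), (p : NumberField.RingOfIntegers F) ∈ v.asIdeal → Pi.1.IsUnramifiedAt v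

/-- item stmt-Langlands-18277 · crux · rank 9 · open · by planner
why it might fail: it is the rest of GL_n reciprocity: fails if (A) fails for an irregular π or (B) fails beyond the regular CM world while X holds; potential ⇒ actual automorphy over K needs insoluble descent (SolvableImageBarrier).
sources: BuzzardGeeLMS2014, FontaineMazurGeometric1995, Calegari2023, ACCGHLNSTT2023
[crux] the junction X → Langlands: everything in the summit outside the gapped Fontaine–Laffaille
potential-automorphy cell over CM fields (descent K' → K, the consecutive-weight cell
(StickelbergerDial), weights outside the FL box, irregular π, non-CM F, direction (A), local–global
compatibility at every place, the reciprocity data 𝓡). Not this route's business; filed so that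
closes ends in the summit constant (pattern of StickelbergerDial.SectorComplement,
AnalyticDescent.SectorComplement, EisensteinGelfandKirillov.SectorComplement). [deps:
GappedWeightPA] [difficulty: open-problem] -/
@[route_item "route-Langlands-TameTypeSwitch", crux]
def SectorComplement : Prop :=
  GappedWeightPA → _root_.Langlands

/-- item stmt-Langlands-18278 · assembly · rank 1 · closed · proved by Summit.Langlands.Langlands.Theorems.tameTypeSwitch_assembly_proof @ 264277954012 (prover) · by planner
sources: ACCGHLNSTT2023, Qian2022
[assembly] TameTypedWitness → TypedWitnessFLLifting → SectorComplement → Langlands (two applications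
and one ∃-repacking; pure logic). -/
@[route_item "route-Langlands-TameTypeSwitch", crux]
def Assembly : Prop :=
  TameTypedWitness → TypedWitnessFLLifting → SectorComplement → _root_.Langlands

-- `Assembly` holds: proved by `Summit.Langlands.Langlands.Theorems.tameTypeSwitch_assembly_proof` @ 264277954012 (its module imports this route file, so no `_holds` link can be stated here).

/-! D-0027 §2.1 — DECIDING THEOREM (planner-authored via `route open/edit --closes-file`; by planner-plan-novel-Langlands-Langlands-e266a39d-c-v2-g20-0 2026-08-17T14:44:49Z):
its hypotheses are this route's items and its conclusion the sub-problem Statement (glue_lint), and it elaborates with this file. -/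

@[closes "route-Langlands-TameTypeSwitch"] theorem closes (hW : TameTypedWitness) (hL : TypedWitnessFLLifting) (hJ : SectorComplement)
    (hA : Assembly) : _root_.Langlands :=
  hA hW hL hJ

end Summit.Langlands.Langlands.Theses.TameTypeSwitch
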